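import Literature.Analysis.Asymptotics.LaplaceMethodOrbitCompact

/-!
# Laplace's method on one non-degenerate critical orbit — amplitude localised to an OPEN INVARIANT SET
# (the «window-event» edition: `β^{m/2} ∫ e^{−β(f−f₀)} 1_O φ dμ`)

Topic `Literature/Analysis/Asymptotics`; namespace `Literature.Analysis.Asymptotics`.  Sequel of `LaplaceMethodOrbitCompact.lean`
(★★★ `tendsto_laplaceMethod_orbit_indicator_of_continuous`: the one-orbit theorem for the TUBE-localised amplitude `1_{T_r} φ`,
`T_r = Θ(K × ball 0 r)`, structural hypotheses only) and `LaplaceMethodSeveralOrbits.lean` (★ `tendsto_laplaceMethod_sum_of_tubes`: the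
tube contributions plus an exponentially small remainder off the tubes).  Everything here is PROVED; no definitions, no named facts.

WHY THIS FILE.  A consumer whose amplitude is the indicator of an OPEN, INVARIANT event `O` containing the critical orbit, times a
continuous invariant weight `φ` — the shape `1_{histGood} · jac` of the constrained small-field fibre densities of lattice gauge theory
([Balaban1985UV3] (2), (41): the window density at height `K − J` is a fibre integral of `1_{small fields} · e^{−βA}`; cell `ym3-torus`,
LINE «semiclassical isolation table for S2β», stub LAPLACE, clause (T)) — cannot use the ★★★ theorem directly (its amplitude is cut to a
tube, which is not the event) nor `tendsto_laplaceMethod_sum_orbits_of_continuous` (which wants a continuous amplitude and the global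
inequality `f ≥ f₀` on all of `X`; on the complement of the event the phase may well go below `f₀` — only the event is charged).  The
present edition is exactly in between: the phase is controlled ON `O` ONLY — `f ≥ f(σ 0)` on `O` and, off every orbit tube, `f ≥ f(σ 0) + η(r)`
on `O` (the shape a quadratic growth from the orbit gives) — and nothing is assumed off `O`, where the integrand vanishes identically.

* §1 `exists_tube_subset_of_isOpen_invariant` — small orbit tubes `Θ(K × ball 0 r)` lie inside any open invariant `O ∋ σ 0`;
  `indicator_tube_indicator_eq` — on such a tube `1_{T_r}(1_O φ) = 1_{T_r} φ`.
* §2 ★ `tendsto_laplaceMethod_orbit_openSet_of_continuous` — SETTING of the ★★★ theorem verbatim (compact first-countable group `K` with a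
  Haar measure `ν` acting jointly continuously by `μ`-preserving maps on a compact second-countable Hausdorff `X` with a finite Borel measure `μ`;
  transversal `σ`, group chart `e`, tube map `Θ`, local product chart `Θ'` with continuous density `J` on an open window `W` and the chart identity
  `μ|_{Θ'(W)} = Θ'_*((J · κ ⊗ dy)|_W)`; slice data `hstab ∕ hfix`; continuous invariant phase `f` and weight `φ`; symmetric positive `A` with the
  Peano expansion of `f ∘ σ` at `0`), PLUS an open invariant `O ∋ σ 0` with `f ≥ f(σ 0)` on `O` and the off-tube separation on `O`.  CONCLUSION:
  `β^{m/2} ∫_X e^{−β(f − f(σ0))} 1_O φ dμ ⟶ (2π)^{m/2} · ν(K) · ((∫_{ball 0 ρ} J(z,0) dκ) ∕ ν(((e(ball 0 ρ))·S)⁻¹)) · φ(σ 0) ∕ √det A` — the same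
  orbit constant as the tube edition (proof: choose `r ≤ r₁` with `T_r ⊆ O`, then `tendsto_laplaceMethod_sum_of_tubes` with ONE tube and amplitude
  `1_O φ`; the tail hypotheses hold on the support of `1_O φ`, i.e. on `O`).
* §2 (cont.) `exists_sep_of_growth` — the off-tube separation on `O` from a continuous GROWTH FUNCTION `g ≥ 0`, positive off the orbit, with
  `f ≥ f(σ 0) + g` on `O` (the shape of a quadratic-growth estimate, [Balaban1985Variational] (142)); ★★ `tendsto_laplaceMethod_orbit_openSet_of_growth`
  — the same theorem with `hf₀ ∕ hsep` replaced by the growth function.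

HONEST SCOPE.  Asymptotic analysis at fixed everything else; nothing uniform in auxiliary parameters; nothing here bears on the Yang–Mills
mass gap (Clay), which is NOT proved; in cell `ym3-torus` it serves one letter (LIMIT) of one stub (LAPLACE) of one line on the rung-R3 crux
`FluctuationComparisonRegPrIntL`, itself NOT proved.

## References
* E. Hasenpflug, D. Rudolf, B. Sprungk, *Wasserstein convergence rates of increasingly concentrating probability measures*,
  Ann. Appl. Probab. 34 (2024): §3.1 Assumption 3 (M)(T), §3.4 (the part off the tubular neighbourhoods is exponentially small).
  [HasenpflugRudolfSprungk2024]
* C.-R. Hwang, *Laplace's method revisited: weak convergence of probability measures*, Ann. Probab. 8 (1980) 1177–1182, main theorem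
  (hypothesis: the infimum of the phase off a neighbourhood of the minimum set exceeds the minimum). [Hwang1980]
* K. W. Breitung, *Asymptotic Approximations for Probability Integrals*, LNM 1592 (1994), Thm 41 p. 56 and its proof (localisation to a
  neighbourhood of the minimum point). [Breitung1994]
* G. E. Bredon, *Introduction to Compact Transformation Groups* (1972), Ch. II §§4–5 (tubes). [Bredon1972]
-/

noncomputable section

open _root_.MeasureTheory _root_.MeasureTheory.Measure _root_.Filter _root_.Set _root_.Module _root_.Metric
open scoped _root_.Topology _root_.Real _root_.InnerProductSpace _root_.ENNReal _root_.NNReal _root_.Pointwise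

namespace Literature.Analysis.Asymptotics

/-! ## §1 Small tubes inside an open invariant event -/

section TubeInOpen

variable {K X V : Type*} [TopologicalSpace X] [SeminormedAddCommGroup V] {act : K → X → X} {σ : V → X} {Θ : K × V → X}

/-- **Small orbit tubes lie inside any open invariant event through the base point**: if `O` is open, `act`-invariant and contains
`σ 0`, then `Θ(K × ball 0 r) ⊆ O` for all small `r > 0` (`σ` continuous at `0`). [cite: Bredon1972, Ch. II §4 (tubes about an orbit)] -/
theorem exists_tube_subset_of_isOpen_invariant (hσ : ContinuousAt σ 0) (hΘ : ∀ k y, Θ (k, y) = act k (σ y))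
    {O : Set X} (hO : IsOpen O) (hinv : ∀ k x, x ∈ O → act k x ∈ O) (h0 : σ 0 ∈ O) :
    ∃ r₀ : ℝ, 0 < r₀ ∧ ∀ r : ℝ, r ≤ r₀ → Θ '' (univ ×ˢ ball (0 : V) r) ⊆ O := by
  have hpre : σ ⁻¹' O ∈ 𝓝 (0 : V) := hσ.preimage_mem_nhds (hO.mem_nhds h0)
  obtain ⟨r₀, hr₀, hball⟩ := Metric.mem_nhds_iff.1 hpre
  refine ⟨r₀, hr₀, fun r hrr₀ => ?_⟩
  rintro x ⟨⟨k, y⟩, ⟨-, hy⟩, rfl⟩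
  rw [hΘ]
  exact hinv k (σ y) (hball (ball_subset_ball hrr₀ hy))

omit [TopologicalSpace X] [SeminormedAddCommGroup V] in
/-- On a tube inside `O`, cutting the amplitude `1_O φ` to the tube is cutting `φ` to the tube. [cite: Bredon1972, Ch. II §4 (bookkeeping)] -/
theorem indicator_tube_indicator_eq {T O : Set X} (hTO : T ⊆ O) (φ : X → ℝ) :
    T.indicator (O.indicator φ) = T.indicator φ := by
  funext x
  by_cases hx : x ∈ T
  · rw [indicator_of_mem hx, indicator_of_mem hx, indicator_of_mem (hTO hx)]
  · rw [indicator_of_notMem hx, indicator_of_notMem hx]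

end TubeInOpen

/-! ## §2 One non-degenerate critical orbit, amplitude `1_O · φ` — structural hypotheses only -/

section OpenAmplitude

variable {V : Type*} [NormedAddCommGroup V] [InnerProductSpace ℝ V] [FiniteDimensional ℝ V]
  [MeasurableSpace V] [BorelSpace V]
variable {Z : Type*} [NormedAddCommGroup Z] [NormedSpace ℝ Z] [FiniteDimensional ℝ Z]
  [MeasurableSpace Z] [BorelSpace Z]
variable {K : Type*} [Group K] [TopologicalSpace K] [IsTopologicalGroup K] [CompactSpace K]
  [FirstCountableTopology K] [MeasurableSpace K] [BorelSpace K]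
variable {X : Type*} [TopologicalSpace X] [CompactSpace X] [T2Space X] [SecondCountableTopology X]
  [MeasurableSpace X] [BorelSpace X]
variable {act : K → X → X} {σ : V → X} {e : Z → K} {Θ : K × V → X} {Θ' : Z × V → X} {S : Set K}
  {ν : Measure K} [ν.IsHaarMeasure] {μ : Measure X} [IsFiniteMeasure μ]
  {κ : Measure Z} [SFinite κ] [IsFiniteMeasureOnCompacts κ]

/-- ★ **Laplace's method on one non-degenerate critical orbit, amplitude localised to an OPEN INVARIANT EVENT.**  SETTING as in
`tendsto_laplaceMethod_orbit_indicator_of_continuous` (compact first-countable group `K` with a Haar measure `ν`; compact second-countable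
Hausdorff `X` with a finite Borel measure `μ`; `act` jointly continuous by `μ`-preserving maps; `σ : V → X`, `e : Z → K` continuous, `e 0 = 1`, `e`
open at `0`; `Θ(k, y) = k • σ y`, `Θ'(z, y) = e z • σ y`, `Θ'` open at the origin; chart data `W, J, hchart, ρ`; slice data `hstab, hfix`; `f, φ`
continuous and invariant; `A` symmetric positive with the Peano expansion `hS2`), PLUS an OPEN `act`-INVARIANT event `O ∋ σ 0` on which the phase is
charged: `f ≥ f(σ 0)` on `O`, and for every `r > 0` some `η > 0` with `f ≥ f(σ 0) + η` on `O` off the tube `Θ(K × ball 0 r)`.  Nothing is assumed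
off `O`.  CONCLUSION:
`β^{m/2} ∫_X e^{−β(f − f(σ0))} 1_O φ dμ ⟶ (2π)^{m/2} · ν(K) · ((∫_{ball 0 ρ} J(z,0) dκ) ∕ ν(((e(ball 0 ρ))·S)⁻¹)) · φ(σ 0) ∕ √det A`.
[cite: HasenpflugRudolfSprungk2024, §3.1 Assumption 3 (M)(T) and §3.4 (one tube plus the exponentially small part off it)]
[cite: Hwang1980, main theorem] [cite: Breitung1994, Thm 41 p. 56 and its proof] [cite: Bredon1972, Ch. II §§4–5] -/
theorem tendsto_laplaceMethod_orbit_openSet_of_continuous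
    (hact : Continuous fun p : K × X => act p.1 p.2)
    (hmul : ∀ k k' x, act (k * k') x = act k (act k' x)) (hone : ∀ x, act 1 x = x)
    (hpres : ∀ k, MeasurePreserving (act k) μ μ)
    (hσ : Continuous σ) (he : Continuous e) (he1 : e 0 = 1) (he𝓝 : 𝓝 (1 : K) ≤ map e (𝓝 0))
    (hΘ : ∀ k y, Θ (k, y) = act k (σ y)) (hΘ' : ∀ z y, Θ' (z, y) = act (e z) (σ y))
    (hΘ'𝓝 : 𝓝 (σ 0) ≤ map Θ' (𝓝 0))
    {W : Set (Z × V)} (hWo : IsOpen W) (hinj : InjOn Θ' W)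
    {J : Z × V → ℝ} (hJc : ContinuousOn J W) (hJ0 : ∀ w ∈ W, 0 ≤ J w)
    (hchart : μ.restrict (Θ' '' W) =
      (((κ.prod volume).restrict W).withDensity fun w => ENNReal.ofReal (J w)).map Θ')
    {ρ : ℝ} (hρ : 0 < ρ) (hρW : closedBall (0 : Z) ρ ×ˢ {(0 : V)} ⊆ W)
    (hstab : ∀ k : K, act k (σ 0) = σ 0 → k ∈ S) (hfix : ∀ s ∈ S, ∀ y, act s (σ y) = σ y)
    {f φ : X → ℝ} (hf : Continuous f) (hφ : Continuous φ)
    (hfinv : ∀ k x, f (act k x) = f x) (hφinv : ∀ k x, φ (act k x) = φ x)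
    {A : V →ₗ[ℝ] V} (hAs : A.IsSymmetric) (hpos : ∀ y, y ≠ 0 → 0 < ⟪A y, y⟫_ℝ)
    (hS2 : (fun y => f (σ y) - f (σ 0) - (1 / 2) * ⟪A y, y⟫_ℝ) =o[𝓝 0] fun y => ‖y‖ ^ 2)
    {O : Set X} (hO : IsOpen O) (hOinv : ∀ k x, x ∈ O → act k x ∈ O) (hO0 : σ 0 ∈ O)
    (hf₀ : ∀ x ∈ O, f (σ 0) ≤ f x)
    (hsep : ∀ r : ℝ, 0 < r → ∃ η : ℝ, 0 < η ∧ ∀ x ∈ O, x ∉ Θ '' (univ ×ˢ ball (0 : V) r) → f (σ 0) + η ≤ f x) :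
    Tendsto (fun β : ℝ => β ^ ((finrank ℝ V : ℝ) / 2) *
        ∫ x, Real.exp (-β * (f x - f (σ 0))) * O.indicator φ x ∂μ) atTop
      (𝓝 ((2 * π) ^ ((finrank ℝ V : ℝ) / 2) * (ν.real univ *
        ((∫ z in ball (0 : Z) ρ, J (z, 0) ∂κ) / (ν (((e '' ball (0 : Z) ρ) * S)⁻¹)).toReal * φ (σ 0) /
          Real.sqrt (LinearMap.det A))))) := by
  classical
  -- the tube edition, with its free radius
  obtain ⟨r₁, hr₁, hmain⟩ := tendsto_laplaceMethod_orbit_indicator_of_continuous (ν := ν) (κ := κ) hact hmul hone hpres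
    hσ he he1 he𝓝 hΘ hΘ' hΘ'𝓝 hWo hinj hJc hJ0 hchart hρ hρW hstab hfix hf hφ hfinv hφinv hAs hpos hS2
  -- a radius at which the tube lies inside `O`
  obtain ⟨r₀, hr₀, hTO⟩ := exists_tube_subset_of_isOpen_invariant (Θ := Θ) hσ.continuousAt hΘ hO hOinv hO0
  set r : ℝ := min r₀ r₁ with hr_def
  have hr : 0 < r := lt_min hr₀ hr₁
  set T : Set X := Θ '' (univ ×ˢ ball (0 : V) r) with hT_def
  have hT_O : T ⊆ O := hTO r (min_le_left _ _)
  have hlimT := hmain r hr (min_le_right _ _)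
  obtain ⟨η, hη, hsep'⟩ := hsep r hr
  -- continuity ⇒ measurability
  have hΘc : Continuous Θ := by
    have h : Θ = fun p : K × V => act p.1 (σ p.2) := funext fun p => hΘ p.1 p.2
    rw [h]
    exact hact.comp (continuous_fst.prodMk (hσ.comp continuous_snd))
  have hTm : MeasurableSet T := measurableSet_image_prod_ball hΘc isCompact_univ 0 r
  set φ' : X → ℝ := O.indicator φ with hφ'_def
  have hφ'm : Measurable φ' := hφ.measurable.indicator hO.measurableSet
  have hφ'O : ∀ x, φ' x ≠ 0 → x ∈ O := fun x hx => by
    by_contra h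
    exact hx (indicator_of_notMem h φ)
  -- integrability of the weight at `β₀ = 0`
  have hint : Integrable (fun x => Real.exp (-(0 : ℝ) * f x) * φ' x) μ := by
    have h1 : Integrable φ' μ := by
      have hc : Integrable φ μ := (integrableOn_univ.1 (hφ.continuousOn.integrableOn_compact isCompact_univ))
      exact hc.indicator hO.measurableSet
    refine (h1.congr (Eventually.of_forall fun x => ?_))
    simp only [neg_zero, zero_mul, Real.exp_zero, one_mul]
  -- the one-tube bookkeeping
  have hsum := tendsto_laplaceMethod_sum_of_tubes (μ := μ) (ι := Unit) (T := fun _ => T) (f := f) (φ := φ')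
    (f₀ := f (σ 0)) (η₀ := η) (β₀ := 0) (ℓ := fun _ => (2 * π) ^ ((finrank ℝ V : ℝ) / 2) * (ν.real univ *
        ((∫ z in ball (0 : Z) ρ, J (z, 0) ∂κ) / (ν (((e '' ball (0 : Z) ρ) * S)⁻¹)).toReal * φ (σ 0) /
          Real.sqrt (LinearMap.det A)))) ((finrank ℝ V : ℝ) / 2)
    hf.measurable hφ'm (fun _ => hTm) (fun i j hij => (hij (Subsingleton.elim i j)).elim)
    (fun x hx => hf₀ x (hφ'O x hx)) hη
    (fun x hxT hx => hsep' x (hφ'O x hx) (by simpa only [mem_iUnion, exists_const] using hxT))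
    hint (fun _ => by simpa only [hφ'_def, indicator_tube_indicator_eq hT_O] using hlimT)
  simpa only [Finset.univ_unique, Finset.sum_singleton] using hsum


omit [InnerProductSpace ℝ V] [FiniteDimensional ℝ V] [MeasurableSpace V] [BorelSpace V] [NormedSpace ℝ Z] [FiniteDimensional ℝ Z]
  [MeasurableSpace Z] [BorelSpace Z] [IsTopologicalGroup K] [CompactSpace K] [FirstCountableTopology K] [MeasurableSpace K] [BorelSpace K]
  [T2Space X] [SecondCountableTopology X] [MeasurableSpace X] [BorelSpace X] in
/-- **SEPARATION OFF EVERY ORBIT TUBE FROM A GROWTH FUNCTION** (the quadratic-growth shape, e.g. [Balaban1985Variational] (142): excess action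
`≥ μ · dist(·, orbit)²`): `X` compact; `g ≥ 0` continuous on `X`, positive off the orbit `K • σ 0`; the phase satisfies `f ≥ f(σ 0) + g` on `O`.  Then for
every `r > 0`, `f ≥ f(σ 0) + η(r)` on `O` off the tube `Θ(K × ball 0 r)` for some `η(r) > 0` — the tube being a neighbourhood of every orbit point
(`tube_mem_nhds_orbit`). [cite: HasenpflugRudolfSprungk2024, §3.1 Assumption 3 (T)] [cite: Hwang1980, main theorem (hypothesis)]
[cite: Bredon1972, Ch. II §§4–5] -/
theorem exists_sep_of_growth
    (hact : Continuous fun p : K × X => act p.1 p.2)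
    (hmul : ∀ k k' x, act (k * k') x = act k (act k' x)) (hone : ∀ x, act 1 x = x)
    (hΘ : ∀ k y, Θ (k, y) = act k (σ y)) (hΘ' : ∀ z y, Θ' (z, y) = act (e z) (σ y))
    (hΘ'𝓝 : 𝓝 (σ 0) ≤ map Θ' (𝓝 0))
    {g : X → ℝ} (hg : Continuous g) (hg0 : ∀ x, 0 ≤ g x) (hgpos : ∀ x, (∀ k, act k (σ 0) ≠ x) → 0 < g x)
    {O : Set X} {f : X → ℝ} (hgrow : ∀ x ∈ O, f (σ 0) + g x ≤ f x) {r : ℝ} (hr : 0 < r) :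
    ∃ η : ℝ, 0 < η ∧ ∀ x ∈ O, x ∉ Θ '' (univ ×ˢ ball (0 : V) r) → f (σ 0) + η ≤ f x := by
  have hU : ∀ x, f (σ 0) + g x = f (σ 0) → Θ '' (univ ×ˢ ball (0 : V) r) ∈ 𝓝 x := by
    intro x hx
    have hgx : g x = 0 := by linarith
    by_cases horb : ∀ k, act k (σ 0) ≠ x
    · exact absurd hgx (hgpos x horb).ne'
    · push Not at horb
      obtain ⟨k, rfl⟩ := horb
      have h0 : 𝓝 (σ 0) ≤ map Θ' (𝓝 ((0 : Z), (0 : V))) := by simpa only [Prod.zero_eq_mk] using hΘ'𝓝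
      exact tube_mem_nhds_orbit hact hmul hone hΘ hΘ' h0 (ball_mem_nhds 0 hr) k
  obtain ⟨η, hη, hsep⟩ := exists_pos_forall_le_of_notMem (f := fun x => f (σ 0) + g x) (f₀ := f (σ 0))
    (continuous_const.add hg) (fun x => le_add_of_nonneg_right (hg0 x)) hU
  exact ⟨η, hη, fun x hxO hxT => (hsep x hxT).trans (hgrow x hxO)⟩

/-- ★★ **Laplace's method on one non-degenerate critical orbit, amplitude `1_O · φ`, tail from a GROWTH FUNCTION** — the edition a
quadratic-growth estimate feeds directly: as `tendsto_laplaceMethod_orbit_openSet_of_continuous`, with the off-tube separation `hsep` REPLACED by a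
continuous `g ≥ 0` on `X`, positive off the orbit `K • σ 0`, with `f ≥ f(σ 0) + g` on `O` (which also gives `f ≥ f(σ 0)` on `O`).  Same conclusion.
[cite: HasenpflugRudolfSprungk2024, §3.1 Assumption 3 (M)(T) and §3.4] [cite: Hwang1980, main theorem] [cite: Breitung1994, Thm 41 p. 56]
[cite: Bredon1972, Ch. II §§4–5] -/
theorem tendsto_laplaceMethod_orbit_openSet_of_growth
    (hact : Continuous fun p : K × X => act p.1 p.2)
    (hmul : ∀ k k' x, act (k * k') x = act k (act k' x)) (hone : ∀ x, act 1 x = x)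
    (hpres : ∀ k, MeasurePreserving (act k) μ μ)
    (hσ : Continuous σ) (he : Continuous e) (he1 : e 0 = 1) (he𝓝 : 𝓝 (1 : K) ≤ map e (𝓝 0))
    (hΘ : ∀ k y, Θ (k, y) = act k (σ y)) (hΘ' : ∀ z y, Θ' (z, y) = act (e z) (σ y))
    (hΘ'𝓝 : 𝓝 (σ 0) ≤ map Θ' (𝓝 0))
    {W : Set (Z × V)} (hWo : IsOpen W) (hinj : InjOn Θ' W)
    {J : Z × V → ℝ} (hJc : ContinuousOn J W) (hJ0 : ∀ w ∈ W, 0 ≤ J w)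
    (hchart : μ.restrict (Θ' '' W) =
      (((κ.prod volume).restrict W).withDensity fun w => ENNReal.ofReal (J w)).map Θ')
    {ρ : ℝ} (hρ : 0 < ρ) (hρW : closedBall (0 : Z) ρ ×ˢ {(0 : V)} ⊆ W)
    (hstab : ∀ k : K, act k (σ 0) = σ 0 → k ∈ S) (hfix : ∀ s ∈ S, ∀ y, act s (σ y) = σ y)
    {f φ : X → ℝ} (hf : Continuous f) (hφ : Continuous φ)
    (hfinv : ∀ k x, f (act k x) = f x) (hφinv : ∀ k x, φ (act k x) = φ x)
    {A : V →ₗ[ℝ] V} (hAs : A.IsSymmetric) (hpos : ∀ y, y ≠ 0 → 0 < ⟪A y, y⟫_ℝ)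
    (hS2 : (fun y => f (σ y) - f (σ 0) - (1 / 2) * ⟪A y, y⟫_ℝ) =o[𝓝 0] fun y => ‖y‖ ^ 2)
    {O : Set X} (hO : IsOpen O) (hOinv : ∀ k x, x ∈ O → act k x ∈ O) (hO0 : σ 0 ∈ O)
    {g : X → ℝ} (hg : Continuous g) (hg0 : ∀ x, 0 ≤ g x) (hgpos : ∀ x, (∀ k, act k (σ 0) ≠ x) → 0 < g x)
    (hgrow : ∀ x ∈ O, f (σ 0) + g x ≤ f x) :
    Tendsto (fun β : ℝ => β ^ ((finrank ℝ V : ℝ) / 2) *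
        ∫ x, Real.exp (-β * (f x - f (σ 0))) * O.indicator φ x ∂μ) atTop
      (𝓝 ((2 * π) ^ ((finrank ℝ V : ℝ) / 2) * (ν.real univ *
        ((∫ z in ball (0 : Z) ρ, J (z, 0) ∂κ) / (ν (((e '' ball (0 : Z) ρ) * S)⁻¹)).toReal * φ (σ 0) /
          Real.sqrt (LinearMap.det A))))) :=
  tendsto_laplaceMethod_orbit_openSet_of_continuous (ν := ν) (κ := κ) hact hmul hone hpres hσ he he1 he𝓝 hΘ hΘ' hΘ'𝓝 hWo hinj
    hJc hJ0 hchart hρ hρW hstab hfix hf hφ hfinv hφinv hAs hpos hS2 hO hOinv hO0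
    (fun x hx => (le_add_of_nonneg_right (hg0 x)).trans (hgrow x hx))
    (fun _ hr => exists_sep_of_growth (Θ := Θ) hact hmul hone hΘ hΘ' hΘ'𝓝 hg hg0 hgpos hgrow hr)

end OpenAmplitude

end Literature.Analysis.Asymptotics

end
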